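import Mathlib
import HarnessLib
import Summits.ValiantsHypothesis.ValiantsHypothesis.Theorems.MonotoneRestorationOrbitRestorationQPBlockUntwisted
import Summits.ValiantsHypothesis.ValiantsHypothesis.Theorems.MonotoneRestorationOrbitRestorationQPBlockTransport
import Summits.ValiantsHypothesis.ValiantsHypothesis.Theorems.MonotoneRestorationOrbitRestorationQPLocalFormShape

/-!
# Support blocks: a row/column-supported affine form is a polynomial in the local atoms at the canonical placement

Route MonotoneRestoration, crux `OrbitRestorationQP` (stmt-ValiantsHypothesis-18293), SPAN-currency lane of the open
sub-rung A_∞ (`stub_sigmaPiSigmaValue`), `ΠΣ` part, twisted residue.  Helper (`--supports`), def-free.  First piece of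
the bookkeeping from the route's structure theorem (`LocalFactors.exists_rowColSupports_of_matrixSymmetric`,
`LocalFormShape.eq_localForm_of_rowCol_invariant`) to the abstract block theorem
`NormalisedFactors.prod_mem_narrowSpan_of_blockUntwisted`:

* **`exists_polyU_eq_aeval_of_rowCol_invariant`** — an affine form fixed by the row permutations fixing `A` pointwise
  and by the column permutations fixing `B` pointwise IS `P(x_{φ a, ψ b}, R_{φ a}, C_{ψ b}, U)` for a polynomial `P` in
  the local atoms and `U` of the core `Fin |A| × Fin |B|`, at the CANONICAL placement `φ = A.equivFin.symm`,
  `ψ = B.equivFin.symm` (so all factors of one support block share the placement, and the block is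
  `aeval` of the product of their polynomials);
* **`prod_mem_narrowSpan_of_supportBlockUntwisted`** — THE BLOCK-UNTWISTED THEOREM for matrix-symmetric affine
  products: given `C a · Π_i L_i ≠ 0` (degree-one factors) invariant under all row/column renamings, and row/column
  SUPPORT maps `R, C` (unit-invariant, equivariant, `|R (L_i)|, |C (L_i)| < k`, pointwise fixers fix — the output of
  `LocalFactors.exists_rowColSupports_of_matrixSymmetric`), if NO renaming rescales a support block
  `B_{(A,B)} = Π {L_i : R (L_i) = A, C (L_i) = B}` non-trivially (BLOCK-UNTWISTED), then
  `C a · Π_i L_i ∈ span_ℂ {hom_{F,n} : tw F ≤ 2k − 1}` — polynomial orbits.  (Transport of blocks up to units: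
  `exists_unit_labelBlock_rowCol`; assembly: `prod_mem_narrowSpan_of_blockUntwisted`.)

This settles, in span currency, every twisted family whose twists are invisible on support blocks (e.g. the
cube-root-twisted family `Π_q Π (x_{aq} + ω x_{a'q} + ω² x_{a''q})`, whose blocks `a² + b² + c² − ab − bc − ca` are
`Sym`-invariant); the residue of the `ΠΣ` sub-rung in span currency is exactly the SIGN-TWISTED blocks.
No registered stub is closed; the crux and VP ≠ VNP are not moved. [folklore]
-/

noncomputable section

open scoped Pointwise

-- `Summit.ValiantsHypothesis.ValiantsHypothesis.…` is the tree's single-conjunct layout (Sub = Summit).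
set_option linter.dupNamespace false

namespace Summit.ValiantsHypothesis.ValiantsHypothesis.Theorems

namespace NormalisedFactors

open MvPolynomial Finset Equiv ProductAction

variable {n : ℕ}

/-- **A row/column-supported affine form is a polynomial in the local atoms and `U` at the canonical placement of its
supports.** [folklore] -/
theorem exists_polyU_eq_aeval_of_rowCol_invariant (ℓ : MvPolynomial (Fin n × Fin n) ℂ) (hdeg : ℓ.totalDegree ≤ 1)
    (A B : Finset (Fin n))
    (hrow : ∀ ρ : Perm (Fin n), (∀ x ∈ A, ρ x = x) → rename (fun P : Fin n × Fin n => (ρ P.1, P.2)) ℓ = ℓ)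
    (hcol : ∀ ρ : Perm (Fin n), (∀ x ∈ B, ρ x = x) → rename (fun P : Fin n × Fin n => (P.1, ρ P.2)) ℓ = ℓ) :
    ∃ P : MvPolynomial (((Fin A.card × Fin B.card) ⊕ (Fin A.card ⊕ Fin B.card)) ⊕ Unit) ℂ,
      ℓ = aeval (Sum.elim (Sum.elim
          (fun ab : Fin A.card × Fin B.card =>
            (X (((A.equivFin.symm ab.1 : A) : Fin n), ((B.equivFin.symm ab.2 : B) : Fin n)) : MvPolynomial (Fin n × Fin n) ℂ))
          (Sum.elim (fun a : Fin A.card => ∑ j : Fin n, (X (((A.equivFin.symm a : A) : Fin n), j) : MvPolynomial (Fin n × Fin n) ℂ))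
            (fun b : Fin B.card => ∑ j : Fin n, (X (j, ((B.equivFin.symm b : B) : Fin n)) : MvPolynomial (Fin n × Fin n) ℂ))))
          (fun _ : Unit => ∑ i : Fin n, ∑ j : Fin n, (X (i, j) : MvPolynomial (Fin n × Fin n) ℂ))) P := by
  classical
  obtain ⟨β₀, δ, α, β, γ, h⟩ := LocalFormShape.eq_localForm_of_rowCol_invariant ℓ hdeg A B hrow hcol
  refine ⟨C β₀ + C δ * X (Sum.inr ()) +
    ((∑ ab : Fin A.card × Fin B.card,
        C (α (((A.equivFin.symm ab.1 : A) : Fin n), ((B.equivFin.symm ab.2 : B) : Fin n))) * X (Sum.inl (Sum.inl ab))) +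
      (∑ a : Fin A.card, C (β ((A.equivFin.symm a : A) : Fin n)) * X (Sum.inl (Sum.inr (Sum.inl a)))) +
      (∑ b : Fin B.card, C (γ ((B.equivFin.symm b : B) : Fin n)) * X (Sum.inl (Sum.inr (Sum.inr b))))), ?_⟩
  rw [h]
  simp only [map_add, map_mul, map_sum, aeval_C, algebraMap_eq, aeval_X, Sum.elim_inl, Sum.elim_inr]
  congr 2
  · congr 1
    · -- cells
      rw [Fintype.sum_prod_type, ← Finset.sum_coe_sort A, ← Equiv.sum_comp A.equivFin.symm]
      refine Finset.sum_congr rfl fun i _ => ?_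
      rw [← Finset.sum_coe_sort B, ← Equiv.sum_comp B.equivFin.symm]
    · -- row pendants
      rw [← Finset.sum_coe_sort A, ← Equiv.sum_comp A.equivFin.symm]
  · -- column pendants
    rw [← Finset.sum_coe_sort B, ← Equiv.sum_comp B.equivFin.symm]

/-! ### The block-untwisted theorem for matrix-symmetric affine products -/

/-- **BLOCK-UNTWISTED MATRIX-SYMMETRIC AFFINE PRODUCTS HAVE POLYNOMIAL ORBITS (span currency).**  See the module
docstring. [folklore; cite: DwivediPagoSeppelt2026, §8; DixonMortimer1996, Thm 5.2B] -/
theorem prod_mem_narrowSpan_of_supportBlockUntwisted {k : ℕ} (hk : 1 ≤ k) {ι : Type} [Fintype ι]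
    (L : ι → MvPolynomial (Fin n × Fin n) ℂ) (a : ℂ) (hL1 : ∀ i, (L i).totalDegree = 1) (hf0 : C a * ∏ i, L i ≠ 0)
    (hfix : ∀ σ τ : Perm (Fin n),
      rename (fun P : Fin n × Fin n => (σ P.1, τ P.2)) (C a * ∏ i, L i) = C a * ∏ i, L i)
    (R S : MvPolynomial (Fin n × Fin n) ℂ → Finset (Fin n))
    (R1 : ∀ (q : MvPolynomial (Fin n × Fin n) ℂ) (u : ℂ), u ≠ 0 → R (C u * q) = R q)
    (S1 : ∀ (q : MvPolynomial (Fin n × Fin n) ℂ) (u : ℂ), u ≠ 0 → S (C u * q) = S q)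
    (R2 : ∀ (q : MvPolynomial (Fin n × Fin n) ℂ) (σ : Perm (Fin n)), R (vact (K := ℂ) rowHom σ q) = σ • R q)
    (R3 : ∀ (q : MvPolynomial (Fin n × Fin n) ℂ) (τ : Perm (Fin n)), R (vact (K := ℂ) colHom τ q) = R q)
    (S2 : ∀ (q : MvPolynomial (Fin n × Fin n) ℂ) (τ : Perm (Fin n)), S (vact (K := ℂ) colHom τ q) = τ • S q)
    (S3 : ∀ (q : MvPolynomial (Fin n × Fin n) ℂ) (σ : Perm (Fin n)), S (vact (K := ℂ) rowHom σ q) = S q)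
    (hRk : ∀ i, (R (L i)).card < k) (hSk : ∀ i, (S (L i)).card < k)
    (hRfix : ∀ (i : ι) (ρ : Perm (Fin n)), (∀ x ∈ R (L i), ρ x = x) → vact (K := ℂ) rowHom ρ (L i) = L i)
    (hSfix : ∀ (i : ι) (ρ : Perm (Fin n)), (∀ x ∈ S (L i), ρ x = x) → vact (K := ℂ) colHom ρ (L i) = L i)
    (hblock : ∀ (σ τ : Perm (Fin n)) (l : Finset (Fin n) × Finset (Fin n)) (c : ℂ),
      rename (fun P : Fin n × Fin n => (σ P.1, τ P.2))
          (∏ i ∈ (univ : Finset ι).filter (fun i => (R (L i), S (L i)) = l), L i) =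
        C c * ∏ i ∈ (univ : Finset ι).filter (fun i => (R (L i), S (L i)) = l), L i → c = 1) :
    (C a * ∏ i, L i) ∈ Submodule.span ℂ {p : MvPolynomial (Fin n × Fin n) ℂ |
        ∃ (a b : ℕ) (E : Multiset (Fin a × Fin b)),
          Literature.Combinatorics.SimpleGraph.treewidth (SimpleGraph.fromRel fun u v : Fin a ⊕ Fin b =>
            ∃ e ∈ E, u = Sum.inl e.1 ∧ v = Sum.inr e.2) ≤ 2 * k - 1 ∧
          p = Literature.Computability.AlgebraicComplexity.homPoly E n ℂ} := by
  classical
  have hL0 : ∀ i, L i ≠ 0 := by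
    intro i h
    exact hf0 (by rw [Finset.prod_eq_zero (Finset.mem_univ i) h, mul_zero])
  -- labels and blocks
  set lab : MvPolynomial (Fin n × Fin n) ℂ → Finset (Fin n) × Finset (Fin n) := fun q => (R q, S q) with hlab
  set J : Finset (Finset (Fin n) × Finset (Fin n)) := (univ : Finset ι).image (fun i => lab (L i)) with hJ
  set Blk : Finset (Fin n) × Finset (Fin n) → MvPolynomial (Fin n × Fin n) ℂ :=
    fun l => ∏ i ∈ (univ : Finset ι).filter (fun i => lab (L i) = l), L i with hBlk
  have hdecomp : (∏ i, L i) = ∏ l ∈ J, Blk l := by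
    rw [hBlk]
    exact (Finset.prod_fiberwise_of_maps_to (fun i _ => Finset.mem_image_of_mem _ (Finset.mem_univ i)) L).symm
  -- the label action
  have hlab_ren : ∀ (σ τ : Perm (Fin n)) (q : MvPolynomial (Fin n × Fin n) ℂ),
      lab (rename (fun P : Fin n × Fin n => (σ P.1, τ P.2)) q) = (σ • (lab q).1, τ • (lab q).2) := by
    intro σ τ q
    simp only [hlab, rename_prod_eq, R2, R3, S3, S2]
  have hlab_unit : ∀ (q : MvPolynomial (Fin n × Fin n) ℂ) (u : ℂ), u ≠ 0 → lab (C u * q) = lab q := by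
    intro q u hu
    simp only [hlab, R1 q u hu, S1 q u hu]
  have hact_inj : ∀ σ τ : Perm (Fin n), Function.Injective
      (fun l : Finset (Fin n) × Finset (Fin n) => (σ • l.1, τ • l.2)) := by
    intro σ τ l l' h
    simp only [Prod.mk.injEq] at h
    exact Prod.ext (smul_left_cancel σ h.1) (smul_left_cancel τ h.2)
  -- factor-level transport up to units (unique factorisation)
  have hassoc : ∀ (σ τ : Perm (Fin n)) (i : ι), ∃ (i' : ι) (c : ℂ), c ≠ 0 ∧
      rename (fun P : Fin n × Fin n => (σ P.1, τ P.2)) (L i) = C c * L i' := by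
    intro σ τ i
    have hrel := rel_associated_of_rename_prod_eq L a hL1 hf0 σ τ (hfix σ τ)
    have hmem : rename (fun P : Fin n × Fin n => (σ P.1, τ P.2)) (L i) ∈
        ((univ : Finset ι).val.map L).map (rename (fun P : Fin n × Fin n => (σ P.1, τ P.2))) :=
      Multiset.mem_map_of_mem _ (Multiset.mem_map_of_mem _ (Finset.mem_univ_val i))
    obtain ⟨y, hy, hxy⟩ := Multiset.exists_mem_of_rel_of_mem hrel hmem
    obtain ⟨i', -, rfl⟩ := Multiset.mem_map.1 hy
    obtain ⟨c, hc0, hc⟩ := SupportBlocks.exists_C_of_associated hxy.symm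
    exact ⟨i', c, hc0, hc⟩
  -- the action preserves the occurring labels
  have hmapsTo : ∀ (σ τ : Perm (Fin n)) (l : Finset (Fin n) × Finset (Fin n)), l ∈ J → (σ • l.1, τ • l.2) ∈ J := by
    intro σ τ l hl
    rw [hJ, Finset.mem_image] at hl ⊢
    obtain ⟨i, -, rfl⟩ := hl
    obtain ⟨i', c, hc0, hc⟩ := hassoc σ τ i
    refine ⟨i', Finset.mem_univ _, ?_⟩
    rw [← hlab_unit (L i') c hc0, ← hc, hlab_ren]
  -- the block family indexed by the occurring labels
  set B : J → MvPolynomial (Fin n × Fin n) ℂ := fun l => Blk l.1 with hB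
  have hB0 : ∀ l, B l ≠ 0 := fun l => Finset.prod_ne_zero_iff.2 fun i _ => hL0 i
  set κf : Perm (Fin n) → Perm (Fin n) → J → J := fun σ τ l => ⟨(σ • l.1.1, τ • l.1.2), hmapsTo σ τ l.1 l.2⟩ with hκf
  have hκinj : ∀ σ τ, Function.Injective (κf σ τ) := by
    intro σ τ l l' h
    apply Subtype.ext
    have h' := congrArg Subtype.val h
    exact hact_inj σ τ h'
  set κ : Perm (Fin n) → Perm (Fin n) → Perm J := fun σ τ =>
    Equiv.ofBijective (κf σ τ) (Finite.injective_iff_bijective.1 (hκinj σ τ)) with hκ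
  -- block transport up to units
  have hassocB : ∀ (σ τ : Perm (Fin n)) (l : J), ∃ c : ℂ, c ≠ 0 ∧
      rename (fun P : Fin n × Fin n => (σ P.1, τ P.2)) (B l) = C c * B (κ σ τ l) := by
    intro σ τ l
    obtain ⟨c, hc0, hc⟩ := exists_unit_labelBlock_rowCol L a hL1 hf0 σ τ (hfix σ τ) lab
      (fun l : Finset (Fin n) × Finset (Fin n) => (σ • l.1, τ • l.2)) (hact_inj σ τ) hlab_unit
      (fun i => hlab_ren σ τ (L i)) l.1
    exact ⟨c, hc0, by simpa [hB, hBlk, hκ, hκf] using hc⟩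
  have heigenB : ∀ (σ τ : Perm (Fin n)) (l : J) (c : ℂ),
      rename (fun P : Fin n × Fin n => (σ P.1, τ P.2)) (B l) = C c * B l → c = 1 :=
    fun σ τ l c h => hblock σ τ l.1 c (by simpa [hB, hBlk, hlab] using h)
  -- blocks are placed polynomial local forms with `U` at the canonical placement of their supports
  have hrow' : ∀ (i : ι) (ρ : Perm (Fin n)), (∀ x ∈ R (L i), ρ x = x) →
      rename (fun P : Fin n × Fin n => (ρ P.1, P.2)) (L i) = L i := by
    intro i ρ hρ
    have h := hRfix i ρ hρ
    rw [vact_apply] at h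
    have hf : (⇑(rowHom ρ) : Fin n × Fin n → Fin n × Fin n) = fun P => (ρ P.1, P.2) := funext (rowHom_apply ρ)
    rwa [hf] at h
  have hcol' : ∀ (i : ι) (ρ : Perm (Fin n)), (∀ x ∈ S (L i), ρ x = x) →
      rename (fun P : Fin n × Fin n => (P.1, ρ P.2)) (L i) = L i := by
    intro i ρ hρ
    have h := hSfix i ρ hρ
    rw [vact_apply] at h
    have hf : (⇑(colHom ρ) : Fin n × Fin n → Fin n × Fin n) = fun P => (P.1, ρ P.2) := funext (colHom_apply ρ)
    rwa [hf] at h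
  have hloc : ∀ l : J, ∃ (r c : ℕ) (eR : Fin r → Fin n) (eC : Fin c → Fin n)
      (P : MvPolynomial (((Fin r × Fin c) ⊕ (Fin r ⊕ Fin c)) ⊕ Unit) ℂ), r + c + 1 ≤ 2 * k - 1 ∧ Function.Injective eR ∧
      Function.Injective eC ∧
      B l = aeval (Sum.elim (Sum.elim (fun ab : Fin r × Fin c => (X (eR ab.1, eC ab.2) : MvPolynomial (Fin n × Fin n) ℂ))
        (Sum.elim (fun a : Fin r => ∑ j : Fin n, (X (eR a, j) : MvPolynomial (Fin n × Fin n) ℂ))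
          (fun b : Fin c => ∑ j : Fin n, (X (j, eC b) : MvPolynomial (Fin n × Fin n) ℂ))))
        (fun _ : Unit => ∑ i : Fin n, ∑ j : Fin n, (X (i, j) : MvPolynomial (Fin n × Fin n) ℂ))) P := by
    rintro ⟨⟨A, T⟩, hl⟩
    have hl' := hl
    rw [hJ, Finset.mem_image] at hl'
    obtain ⟨i₀, -, hi₀⟩ := hl'
    have hA : R (L i₀) = A := congrArg Prod.fst hi₀
    have hT : S (L i₀) = T := congrArg Prod.snd hi₀
    -- every factor of the block is `aeval` of a polynomial at the canonical placement
    have hP : ∀ i : {i // lab (L i) = (A, T)}, ∃ P : MvPolynomial (((Fin A.card × Fin T.card) ⊕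
        (Fin A.card ⊕ Fin T.card)) ⊕ Unit) ℂ,
        L i = aeval (Sum.elim (Sum.elim
          (fun ab : Fin A.card × Fin T.card =>
            (X (((A.equivFin.symm ab.1 : A) : Fin n), ((T.equivFin.symm ab.2 : T) : Fin n)) : MvPolynomial (Fin n × Fin n) ℂ))
          (Sum.elim (fun a : Fin A.card => ∑ j : Fin n, (X (((A.equivFin.symm a : A) : Fin n), j) : MvPolynomial (Fin n × Fin n) ℂ))
            (fun b : Fin T.card => ∑ j : Fin n, (X (j, ((T.equivFin.symm b : T) : Fin n)) : MvPolynomial (Fin n × Fin n) ℂ))))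
          (fun _ : Unit => ∑ i : Fin n, ∑ j : Fin n, (X (i, j) : MvPolynomial (Fin n × Fin n) ℂ))) P := by
      rintro ⟨i, hi⟩
      have hRi : R (L i) = A := congrArg Prod.fst hi
      have hSi : S (L i) = T := congrArg Prod.snd hi
      exact exists_polyU_eq_aeval_of_rowCol_invariant (L i) (hL1 i).le A T
        (fun ρ hρ => hrow' i ρ (by rw [hRi]; exact hρ)) (fun ρ hρ => hcol' i ρ (by rw [hSi]; exact hρ))
    choose Pf hPf using hP
    refine ⟨A.card, T.card, fun a => ((A.equivFin.symm a : A) : Fin n), fun b => ((T.equivFin.symm b : T) : Fin n),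
      ∏ i : {i // lab (L i) = (A, T)}, Pf i, ?_, ?_, ?_, ?_⟩
    · have h1 := hRk i₀
      have h2 := hSk i₀
      rw [hA] at h1
      rw [hT] at h2
      omega
    · intro a b h
      exact A.equivFin.symm.injective (Subtype.ext h)
    · intro a b h
      exact T.equivFin.symm.injective (Subtype.ext h)
    · simp only [hB, hBlk]
      rw [map_prod, Finset.prod_subtype ((univ : Finset ι).filter fun i => lab (L i) = (A, T))
        (p := fun i => lab (L i) = (A, T)) (fun i => by simp) L]
      exact Fintype.prod_congr _ _ fun i => hPf i
  have hprod := prod_mem_narrowSpan_of_blockUntwisted n (2 * k - 1) B hB0 κ hassocB heigenB hloc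
  -- reassemble `f`
  have hf : C a * ∏ i, L i = C a * ∏ l : J, B l := by
    rw [hdecomp, hB, ← Finset.prod_coe_sort J]
  rw [hf, ← smul_eq_C_mul]
  exact Submodule.smul_mem _ _ hprod

end NormalisedFactors

end Summit.ValiantsHypothesis.ValiantsHypothesis.Theorems

end
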